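import Mathlib.RingTheory.Ideal.Operations
import HarnessLib

/-!
# Venture HSemireg — graded absorption: if `𝔫^m ⊆ O + 𝔫^(m+1)` for all `m ≥ 2`, then `𝔫² ⊆ ⋂ₖ (O + 𝔫ᵏ)`

The last step of THEOREM Γ-1⁵ (δ) of the computation cell `pub-hsemireg` (seat w1-tw-1,
`widen/W1/CLEAN-COMPONENT-THEOREM-w1tw1.md` §26.1): inside an overring `B` of the local ring `O_Z`
of the five-sheet germ, with `𝔫` the ideal of the curve `Γ`, the Hilbert-function argument gives
`𝔫^m ⊆ O_Z + 𝔫^(m+1)` for every `m ≥ 2`; iterating, `𝔫² ⊆ O_Z + 𝔫^M` for every `M`, hence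
`𝔫² ⊆ ⋂_M (O_Z + 𝔫^M)`, and Krull's intersection theorem (an input, not formalised here) identifies
the intersection with `O_Z`. This file is the Lean index of the iteration: for an additive subgroup
`O` of a commutative ring `B` and an ideal `𝔫`,

* `sq_le_sup_pow` — `(∀ m ≥ 2, 𝔫^m ≤ O ⊔ 𝔫^(m+1)) → ∀ M, 𝔫^2 ≤ O ⊔ 𝔫^M`;
* `sq_le_iInf_sup_pow` — hence `𝔫^2 ≤ ⨅ M, (O ⊔ 𝔫^M)`;
* `sq_le_of_graded_absorption` — and `𝔫^2 ≤ O` as soon as `⨅ M, (O ⊔ 𝔫^M) ≤ O` (Krull).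

HONEST FRAMING. Lattice bookkeeping with additive subgroups and ideal powers only; no germ, sheaf,
abelian variety or semiregularity map appears; nothing here says that HC, HC_CM or HC_AV holds, and
nothing here is a new case of anything.
-/

namespace Summit.Ventures.HSemireg

namespace GradedAbsorption

variable {B : Type*} [CommRing B]

/-- Monotonicity transported to additive subgroups: `k ≤ l → 𝔫^l ≤ 𝔫^k`. -/
theorem pow_toAddSubgroup_anti (𝔫 : Ideal B) {k l : ℕ} (hkl : k ≤ l) : (𝔫 ^ l).toAddSubgroup ≤ (𝔫 ^ k).toAddSubgroup := by
  intro x hx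
  exact Ideal.pow_le_pow_right hkl hx

/-- Iteration: if `𝔫^m ≤ O ⊔ 𝔫^(m+1)` for all `m ≥ 2`, then `𝔫^2 ≤ O ⊔ 𝔫^M` for every `M`. -/
theorem sq_le_sup_pow (O : AddSubgroup B) (𝔫 : Ideal B)
    (h : ∀ m, 2 ≤ m → (𝔫 ^ m).toAddSubgroup ≤ O ⊔ (𝔫 ^ (m + 1)).toAddSubgroup) :
    ∀ M, (𝔫 ^ 2).toAddSubgroup ≤ O ⊔ (𝔫 ^ M).toAddSubgroup := by
  intro M
  induction M with
  | zero => exact le_trans (pow_toAddSubgroup_anti 𝔫 (Nat.zero_le 2)) le_sup_right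
  | succ M ih =>
    by_cases hM : 2 ≤ M
    · -- 𝔫² ≤ O ⊔ 𝔫^M ≤ O ⊔ (O ⊔ 𝔫^(M+1)) = O ⊔ 𝔫^(M+1)
      calc (𝔫 ^ 2).toAddSubgroup ≤ O ⊔ (𝔫 ^ M).toAddSubgroup := ih
        _ ≤ O ⊔ (O ⊔ (𝔫 ^ (M + 1)).toAddSubgroup) := sup_le_sup_left (h M hM) O
        _ = O ⊔ (𝔫 ^ (M + 1)).toAddSubgroup := by rw [← sup_assoc, sup_idem]
    · -- M + 1 ≤ 2: 𝔫² ≤ 𝔫^(M+1)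
      have hM1 : M + 1 ≤ 2 := by omega
      exact le_trans (pow_toAddSubgroup_anti 𝔫 hM1) le_sup_right

/-- Hence `𝔫^2 ≤ ⨅ M, (O ⊔ 𝔫^M)`. -/
theorem sq_le_iInf_sup_pow (O : AddSubgroup B) (𝔫 : Ideal B)
    (h : ∀ m, 2 ≤ m → (𝔫 ^ m).toAddSubgroup ≤ O ⊔ (𝔫 ^ (m + 1)).toAddSubgroup) :
    (𝔫 ^ 2).toAddSubgroup ≤ ⨅ M, (O ⊔ (𝔫 ^ M).toAddSubgroup) :=
  le_iInf (sq_le_sup_pow O 𝔫 h)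

/-- **Graded absorption.** If `𝔫^m ≤ O ⊔ 𝔫^(m+1)` for all `m ≥ 2` and the `𝔫`-adic closure of `O`
is `O` itself (`⨅ M, (O ⊔ 𝔫^M) ≤ O` — Krull's intersection theorem in the application), then
`𝔫^2 ≤ O`. -/
theorem sq_le_of_graded_absorption (O : AddSubgroup B) (𝔫 : Ideal B)
    (h : ∀ m, 2 ≤ m → (𝔫 ^ m).toAddSubgroup ≤ O ⊔ (𝔫 ^ (m + 1)).toAddSubgroup)
    (hK : ⨅ M, (O ⊔ (𝔫 ^ M).toAddSubgroup) ≤ O) :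
    (𝔫 ^ 2).toAddSubgroup ≤ O :=
  le_trans (sq_le_iInf_sup_pow O 𝔫 h) hK

end GradedAbsorption

end Summit.Ventures.HSemireg
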